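import Summits.BirchSwinnertonDyer.BirchSwinnertonDyer.Theorems.EisensteinPrimesGoodLatticeMuLambdaDictionary
import Summits.BirchSwinnertonDyer.Rank1Residual.X1.UnrSeriesFirstUnitCoeff
import HarnessLib

/-!
# Route `SchneiderFreeAdditiveX3` (K1 door), crux r3 `GordTwoBranchIMC`: the `R₀⟦T⟧`-ALGEBRA of Keller–Yin's
# "force the equality" step (Thm. 3.5.1 ⟸ Thm. 3.3.6 ∘ Prop. 3.4.4 + §3.5), along an ARBITRARY structure map
# `j : ℤ_p → R₀` — the Wiles / Greenberg–Vatsal hinge in the currency of the typed claims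

Cell `bsd-schneider-ideate`, seat `bsd-schneider-door-c5` (prover, generation 22; assembly layer; `--supports` 19177).
PARTITION: board row B6 ∩ X3 ∩ sst-twist, `r = 1`, (G-ord, `e = 2`) half (2 560 of 7 101 pairs) of
`Rank1Residual.partition`; types-the-object-of nothing new; closes none of B6's cells (BSD NOT advanced).
bears_on: K1-door (items 18971/18972 → 19177 r3).

WHAT.  The typed transcriptions of Keller–Yin arXiv:2410.23241 §3 (`KellerYin2024/PotentiallyGoodOrdinaryIwasawaTheory*.lean`)
quantify their frame clauses over EVERY ring map `j : ℤ_p → R₀ = unrIntegers p` with `(j x : ℂ_p) = x` — not only the tree's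
`toUnr p`.  The `R₀⟦T⟧` algebra that turns the two printed halves of Thm. 3.5.1 into its conclusion (verbatim [p0020:L1]: "The
equalities between the Iwasawa invariants of both sides combined with the one-side divisibility … force the equality") is in
the tree for `toUnr` (cell `bsd-eis`: `EisensteinPrimesMuLambda.firstUnitCoeff_map_toUnr_of_charIdeal_eq_span`, X1
`KellerYinHalves.span_singleton_eq_of_C_pow_mul_mem`); this file states it along an arbitrary such `j`, for a finitely
generated torsion `Λ`-module `X` with `μ(X) = 0` and `Ch_Λ(X)` read in `R₀⟦T⟧` as the image ideal `Ch_Λ(X)·R₀⟦T⟧` along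
`PowerSeries.map j`:
* `norm_coe_structureMap`, `norm_coeff_map_structureMap` — any such `j` is isometric on coefficients;
* `firstUnitCoeff_map_of_charIdeal_eq_span` — for a generator `g` of `Ch_Λ(X)`, the first unit coefficient of `j g` sits at
  `λ(X)` (Weierstrass dictionary, Washington §13.2 / §7.1);
* `charIdeal_map_eq_span_of_C_pow_mul_mem_of_firstUnitCoeff` — **the hinge**: if `p^m · L₀ ∈ Ch_Λ(X)·R₀⟦T⟧` (ONE
  divisibility, with slack) and the first unit coefficient of `L₀` sits at `λ(X)` (equal `μ = 0`, equal `λ`), then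
  `Ch_Λ(X)·R₀⟦T⟧ = (L₀)`;
* `mem_charIdeal_map_of_C_pow_mul_mem` — the Kolyvagin direction sharpened by `μ(X) = 0` ALONE: `p^m · L ∈ Ch_Λ(X)·R₀⟦T⟧ ⟹
  L ∈ Ch_Λ(X)·R₀⟦T⟧` (no `λ`); this is all the WING (upper half) consumes.
Consumed by the sibling `…KYBranchHalves.lean` (Keller–Yin Thm. 3.5.1 in branch currency ⟸ [DIV] ∧ [INV], and the door /
wing leaves on the two halves).  THEOREMS ONLY; pure commutative algebra; nothing about any curve; «closes rung: none».
References: [Washington1997] §7.1 Prop. 7.2, §13.2; [CastellaGrossiLeeSkinner2022] Thm. 3.2.1 ("it suffices to prove one of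
the predicted divisibilities"); [KellerYin2024b] arXiv:2410.23241 §3.5 [p0020:L1] (the sentence this algebra implements).
-/

set_option autoImplicit false
-- `Summit.<P>.<Sub>` repeats `BirchSwinnertonDyer` by the tree's layout convention (D-0017)
set_option linter.dupNamespace false

noncomputable section

open scoped Classical

open PowerSeries Literature.NumberTheory.EllipticCurves
open Summit.BirchSwinnertonDyer.BirchSwinnertonDyer.Theorems.EisensteinPrimesMuLambda (firstUnitCoeff_of_charIdeal_eq_span)
open Summit.BirchSwinnertonDyer.Rank1Residual.X1.KellerYinHalves
  (span_singleton_eq_of_C_pow_mul_mem exists_mul_eq_of_mul_eq_C_pow_mul)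

namespace Summit.BirchSwinnertonDyer.BirchSwinnertonDyer.Theorems.SchneiderFreeAdditiveX3.KYBranchHalves

variable {p : ℕ} [Fact p.Prime]

/-! ### §1 Any structure map `j : ℤ_p → R₀` over `ℂ_p` is isometric on coefficients -/

/-- A ring map `j : ℤ_p → R₀ ⊂ ℂ_p` compatible with `ℤ_p ⊂ ℚ_p ⊂ ℂ_p` preserves norms. [folklore] -/
theorem norm_coe_structureMap (j : ℤ_[p] →+* unrIntegers p)
    (hj : ∀ x : ℤ_[p], ((j x : unrIntegers p) : ℂ_[p]) = algebraMap ℚ_[p] ℂ_[p] (x : ℚ_[p])) (x : ℤ_[p]) :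
    ‖((j x : unrIntegers p) : ℂ_[p])‖ = ‖x‖ := by
  rw [hj, norm_algebraMap', PadicInt.norm_def]

/-- Coefficientwise form: `‖[Tⁱ](map j F)‖_{ℂ_p} = ‖[Tⁱ]F‖_{ℤ_p}`. [folklore] -/
theorem norm_coeff_map_structureMap (j : ℤ_[p] →+* unrIntegers p)
    (hj : ∀ x : ℤ_[p], ((j x : unrIntegers p) : ℂ_[p]) = algebraMap ℚ_[p] ℂ_[p] (x : ℚ_[p]))
    (F : IwasawaAlgebra p) (i : ℕ) :
    ‖((coeff i (PowerSeries.map j F) : unrIntegers p) : ℂ_[p])‖ = ‖coeff i F‖ := by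
  rw [coeff_map, norm_coe_structureMap j hj]

/-! ### §2 The generator of `Ch_Λ(X)` read along `j`: first unit coefficient at `λ(X)` when `μ(X) = 0` -/

/-- **Weierstrass dictionary along `j`.**  For a finitely generated torsion `Λ`-module `X` with `μ(X) = 0` and
`Ch_Λ(X) = (g)`, the first unit coefficient of `map j g ∈ R₀⟦T⟧` (coefficients read in `ℂ_p`) sits at `λ(X)` — the
tree's `firstUnitCoeff_of_charIdeal_eq_span` (cell `bsd-eis`) transported by §1. [cite: Washington1997, §13.2 and §7.1 (Prop. 7.2)] -/
theorem firstUnitCoeff_map_of_charIdeal_eq_span (X : Type*) [AddCommGroup X] [Module (IwasawaAlgebra p) X]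
    [Module.Finite (IwasawaAlgebra p) X] (hX : Module.IsTorsion (IwasawaAlgebra p) X) (hμ : muInvariant p X = 0)
    {g : IwasawaAlgebra p} (hg : Module.charIdeal (IwasawaAlgebra p) X = Ideal.span {g})
    (j : ℤ_[p] →+* unrIntegers p)
    (hj : ∀ x : ℤ_[p], ((j x : unrIntegers p) : ℂ_[p]) = algebraMap ℚ_[p] ℂ_[p] (x : ℚ_[p])) :
    ‖((coeff (lambdaInvariant p X) (PowerSeries.map j g) : unrIntegers p) : ℂ_[p])‖ = 1 ∧
      ∀ i < lambdaInvariant p X, ‖((coeff i (PowerSeries.map j g) : unrIntegers p) : ℂ_[p])‖ < 1 := by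
  obtain ⟨h1, h2⟩ := firstUnitCoeff_of_charIdeal_eq_span X hX hμ hg
  exact ⟨by rw [norm_coeff_map_structureMap j hj]; exact h1,
    fun i hi ↦ by rw [norm_coeff_map_structureMap j hj]; exact h2 i hi⟩

/-- `Ch_Λ(X)` is principal; a named generator. [cite: Washington1997, §13.2] -/
theorem exists_charIdeal_eq_span (X : Type*) [AddCommGroup X] [Module (IwasawaAlgebra p) X] :
    ∃ g : IwasawaAlgebra p, Module.charIdeal (IwasawaAlgebra p) X = Ideal.span {g} := by
  haveI : (Module.charIdeal (IwasawaAlgebra p) X).IsPrincipal := charIdeal_isPrincipal_holds p X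
  exact ⟨_, (Ideal.span_singleton_generator _).symm⟩

/-! ### §3 The hinge: one divisibility (with slack) + equal invariants ⟹ equality; and the `μ(X) = 0` sharpening -/

/-- **"Force the equality"** (Keller–Yin §3.5 [p0020:L1]; Wiles / Greenberg–Vatsal / CGLS Thm. 3.2.1).  Let `X` be a
finitely generated torsion `Λ`-module with `μ(X) = 0`, `j : ℤ_p → R₀` a structure map, and `L₀ ∈ R₀⟦T⟧` with its first unit
coefficient at `λ(X)`.  If `p^m · L₀ ∈ Ch_Λ(X)·R₀⟦T⟧` for some `m` (ONE divisibility, Kolyvagin direction, any slack), then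
`Ch_Λ(X)·R₀⟦T⟧ = (L₀)`.  Proof: `Ch_Λ(X) = (g)` with the first unit coefficient of `j g` at `λ(X)` (§2); X1's
`span_singleton_eq_of_C_pow_mul_mem` (cancel `p^m` against the unit coefficient, then the cofactor has a unit constant term).
[cite: Washington1997, §7.1 Prop. 7.2 and §13.2] [cite: CastellaGrossiLeeSkinner2022, Thm. 3.2.1 (proof, last paragraph: one divisibility suffices given equal invariants)] -/
theorem charIdeal_map_eq_span_of_C_pow_mul_mem_of_firstUnitCoeff (X : Type*) [AddCommGroup X]
    [Module (IwasawaAlgebra p) X] [Module.Finite (IwasawaAlgebra p) X]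
    (hX : Module.IsTorsion (IwasawaAlgebra p) X) (hμ : muInvariant p X = 0)
    (j : ℤ_[p] →+* unrIntegers p)
    (hj : ∀ x : ℤ_[p], ((j x : unrIntegers p) : ℂ_[p]) = algebraMap ℚ_[p] ℂ_[p] (x : ℚ_[p]))
    {L₀ : UnrSeries p} {m : ℕ}
    (hL₀ : ‖((coeff (lambdaInvariant p X) L₀ : unrIntegers p) : ℂ_[p])‖ = 1 ∧
      ∀ i < lambdaInvariant p X, ‖((coeff i L₀ : unrIntegers p) : ℂ_[p])‖ < 1)
    (hmem : C ((p : unrIntegers p) ^ m) * L₀ ∈ (Module.charIdeal (IwasawaAlgebra p) X).map (PowerSeries.map j)) :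
    (Module.charIdeal (IwasawaAlgebra p) X).map (PowerSeries.map j) = Ideal.span {L₀} := by
  obtain ⟨g, hg⟩ := exists_charIdeal_eq_span (p := p) X
  have hmap : (Module.charIdeal (IwasawaAlgebra p) X).map (PowerSeries.map j) = Ideal.span {PowerSeries.map j g} := by
    rw [hg, Ideal.map_span, Set.image_singleton]
  rw [hmap] at hmem ⊢
  exact span_singleton_eq_of_C_pow_mul_mem hmem (firstUnitCoeff_map_of_charIdeal_eq_span X hX hμ hg j hj) hL₀

/-- **The Kolyvagin direction sharpened by `μ(X) = 0` alone** (what the WING consumes): for a finitely generated torsion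
`Λ`-module `X` with `μ(X) = 0` and a structure map `j`, `p^m · L ∈ Ch_Λ(X)·R₀⟦T⟧ ⟹ L ∈ Ch_Λ(X)·R₀⟦T⟧` — the generator read in
`R₀⟦T⟧` has a unit coefficient, so `p^m` cancels (X1's `exists_mul_eq_of_mul_eq_C_pow_mul`).  No `λ`-input.
[cite: Washington1997, §7.1 Prop. 7.2 and §13.2] -/
theorem mem_charIdeal_map_of_C_pow_mul_mem (X : Type*) [AddCommGroup X] [Module (IwasawaAlgebra p) X]
    [Module.Finite (IwasawaAlgebra p) X] (hX : Module.IsTorsion (IwasawaAlgebra p) X) (hμ : muInvariant p X = 0)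
    (j : ℤ_[p] →+* unrIntegers p)
    (hj : ∀ x : ℤ_[p], ((j x : unrIntegers p) : ℂ_[p]) = algebraMap ℚ_[p] ℂ_[p] (x : ℚ_[p]))
    {L : UnrSeries p} {m : ℕ}
    (hmem : C ((p : unrIntegers p) ^ m) * L ∈ (Module.charIdeal (IwasawaAlgebra p) X).map (PowerSeries.map j)) :
    L ∈ (Module.charIdeal (IwasawaAlgebra p) X).map (PowerSeries.map j) := by
  obtain ⟨g, hg⟩ := exists_charIdeal_eq_span (p := p) X
  have hmap : (Module.charIdeal (IwasawaAlgebra p) X).map (PowerSeries.map j) = Ideal.span {PowerSeries.map j g} := by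
    rw [hg, Ideal.map_span, Set.image_singleton]
  rw [hmap] at hmem ⊢
  obtain ⟨G, hG⟩ := Ideal.mem_span_singleton'.mp hmem
  obtain ⟨G', hG'⟩ := exists_mul_eq_of_mul_eq_C_pow_mul
    (firstUnitCoeff_map_of_charIdeal_eq_span X hX hμ hg j hj) (G := G) (by rw [mul_comm, hG])
  exact Ideal.mem_span_singleton'.mpr ⟨G', by rw [mul_comm, hG']⟩

/-- **The sharpened Kolyvagin direction as an inclusion of ideals**: under the same hypotheses, `(L) ⊆ Ch_Λ(X)·R₀⟦T⟧`.
[cite: Washington1997, §7.1 Prop. 7.2 and §13.2] -/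
theorem span_le_charIdeal_map_of_C_pow_mul_mem (X : Type*) [AddCommGroup X] [Module (IwasawaAlgebra p) X]
    [Module.Finite (IwasawaAlgebra p) X] (hX : Module.IsTorsion (IwasawaAlgebra p) X) (hμ : muInvariant p X = 0)
    (j : ℤ_[p] →+* unrIntegers p)
    (hj : ∀ x : ℤ_[p], ((j x : unrIntegers p) : ℂ_[p]) = algebraMap ℚ_[p] ℂ_[p] (x : ℚ_[p]))
    {L : UnrSeries p} {m : ℕ}
    (hmem : C ((p : unrIntegers p) ^ m) * L ∈ (Module.charIdeal (IwasawaAlgebra p) X).map (PowerSeries.map j)) :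
    Ideal.span {L} ≤ (Module.charIdeal (IwasawaAlgebra p) X).map (PowerSeries.map j) := by
  rw [Ideal.span_singleton_le_iff_mem]
  exact mem_charIdeal_map_of_C_pow_mul_mem X hX hμ j hj hmem

end Summit.BirchSwinnertonDyer.BirchSwinnertonDyer.Theorems.SchneiderFreeAdditiveX3.KYBranchHalves

end
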